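import Mathlib
import HarnessLib
import Summits.Ventures.LatticeQCDFlow.Scaling.IdentityFlowAcceptanceDiagonalLimit
import Summits.Ventures.LatticeQCDFlow.Scaling.LatticeEntropy

/-!
# LatticeQCDFlow / Scaling — COUPLING TRANSFER on the diagonal: a perfectly trained factorised flow
# re-used at `β = β₀ + c/√V` accepts with limiting probability `erfc(|c|σ(β₀)/2)`

HONEST FRAMING: exact (Metropolis-corrected) sampling algorithms for lattice gauge theory;
figures of merit are autocorrelation/cost numbers at stated couplings and volumes; no
continuum-physics claim.

Venture `LatticeQCDFlow` (cell pub-lqcd), topic `Scaling`; FANOUT row 3 (`s0-u1-a`, S0-B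
implementation A, GEN-19).  NEW WORK of the cell (corollaries of row 3's
`Scaling/IdentityFlowAcceptanceDiagonalLimit`); NO definition is introduced; nothing is cited.

## The statement

A perfectly trained flow for the `n`-block tilt family at coupling `β₀` proposes from
`ν_{β₀}^{⊗n}`, `ν_{β₀} = e^{β₀ g}ν/M(β₀)` (Mathlib's `ν.tilted (β₀ • g)`); re-used at coupling `β` its
equilibrium acceptance is the acceptance of the UNTRAINED sampler of the tilt family built on the
reference law `ν_{β₀}` at coupling `β − β₀` (row 3 GEN-17 (G)/(J), GEN-18 `Scaling/WilsonTransfer*`: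
floor `exp(−KL − |β−β₀| s(β₀))`, window `O(1/√(V ψ″(β₀)))`).  The diagonal scaling limit therefore
gives the EXACT transfer profile:

* `tiltPi_meanAccept_diag_tendsto_of_bounded` — the diagonal limit for a bounded, not necessarily
  centred block statistic (the acceptance functional is invariant under `g ↦ g − E g`);
* **`tiltedPi_transfer_diag_tendsto`** — for EVERY block law `ν`, bounded `g`, training coupling
  `β₀` and real `c`: the acceptance of `ν_{β₀}^{⊗n}`-proposals against the target at
  `β₀ + c/√n` converges to the log-normal law `∫∫ min(e^x, e^y) dN(−s/2, s)²` with
  `s = c²·Var_{ν_{β₀}}(g)` (the block heat capacity `ψ″(β₀)`);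
  **`tiltedPi_transfer_diag_tendsto_erfc`** — `= erfc(|c|σ(β₀)/2)` for `c ≠ 0`, `σ(β₀) ≠ 0`.

* **`haarPi_meanAccept_diag_tendsto`** — the untrained sampler of `V` INDEPENDENT `G`-PLAQUETTES for
  ANY compact group `G` and continuous representation `ρ` with `|Re tr ρ| ≤ N` (proposal Haar^{⊗V},
  weight `e^{β Σ Re tr ρ(U_p)}`): at `β = c/√V` the acceptance → the log-normal law with
  `s = c²·Var_Haar(Re tr ρ)` — U(1), SU(2), SU(3) one-plaquette models alike.

Reading (value-free): a flow trained perfectly at `β₀` and transferred to `β` keeps a non-trivial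
acceptance exactly on the window `|β − β₀| = Θ((V ψ″(β₀))^{−1/2})`, with profile `erfc(|c|σ(β₀)/2)`
along `β − β₀ = c/√V`; training closer than that is wasted, farther is useless.  NOT CLAIMED: the
torus; imperfectly trained flows; any value at the cell's `(β, L)`; nothing re-scored.
-/

noncomputable section

namespace Summit.Ventures.LatticeQCDFlow.Theory2

open MeasureTheory ProbabilityTheory Filter Finset Real Set
open scoped Topology NNReal
open Literature.Probability.Distributions.PseudoMarginalNoise

variable {X : Type*} {mX : MeasurableSpace X} {ν : Measure X} [IsProbabilityMeasure ν] {g : X → ℝ}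

omit [IsProbabilityMeasure ν] in
/-- The acceptance functional of the tilt family is invariant under shifting the block statistic by a
constant: numerator and partition function both pick up the factor `e^{β n m}`. [ours] -/
theorem tiltPi_meanAccept_sub_const (m β : ℝ) (n : ℕ) :
    (∫ x, ∫ y, min (Real.exp (β * ∑ i, (g (x i) - m))) (Real.exp (β * ∑ i, (g (y i) - m)))
          ∂(Measure.pi fun _ : Fin n => ν) ∂(Measure.pi fun _ : Fin n => ν))
        / ∫ x, Real.exp (β * ∑ i, (g (x i) - m)) ∂(Measure.pi fun _ : Fin n => ν)
      = (∫ x, ∫ y, min (Real.exp (β * ∑ i, g (x i))) (Real.exp (β * ∑ i, g (y i)))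
          ∂(Measure.pi fun _ : Fin n => ν) ∂(Measure.pi fun _ : Fin n => ν))
        / ∫ x, Real.exp (β * ∑ i, g (x i)) ∂(Measure.pi fun _ : Fin n => ν) := by
  have e : ∀ x : Fin n → X, Real.exp (β * ∑ i, (g (x i) - m))
      = Real.exp (β * ∑ i, g (x i)) * Real.exp (-(β * n * m)) := fun x => by
    rw [← Real.exp_add]; congr 1
    rw [Finset.sum_sub_distrib, Finset.sum_const, Finset.card_univ, Fintype.card_fin, nsmul_eq_mul]
    ring
  have hE : 0 < Real.exp (-(β * n * m)) := Real.exp_pos _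
  simp_rw [e, ← min_mul_of_nonneg _ _ hE.le, integral_mul_const]
  rw [mul_div_mul_right _ _ hE.ne']

/-- **The diagonal limit for a bounded, not necessarily centred block statistic**: the limit law
has `s = c²·Var g`. [ours] -/
theorem tiltPi_meanAccept_diag_tendsto_of_bounded (hgm : Measurable g) {K : ℝ} (hK : ∀ x, |g x| ≤ K)
    (c : ℝ) :
    Tendsto (fun n : ℕ =>
        (∫ x, ∫ y, min (Real.exp (c / Real.sqrt n * ∑ i, g (x i)))
              (Real.exp (c / Real.sqrt n * ∑ i, g (y i)))
            ∂(Measure.pi fun _ : Fin n => ν) ∂(Measure.pi fun _ : Fin n => ν))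
          / ∫ x, Real.exp (c / Real.sqrt n * ∑ i, g (x i)) ∂(Measure.pi fun _ : Fin n => ν))
      atTop (𝓝 (∫ x, ∫ y, min (Real.exp x) (Real.exp y)
        ∂(noiseLaw (c ^ 2 * Var[g; ν]).toNNReal) ∂(noiseLaw (c ^ 2 * Var[g; ν]).toNNReal))) := by
  set m : ℝ := ∫ x, g x ∂ν with hm
  have hgb : ∀ᵐ x ∂ν, g x ∈ Set.Icc (-K) K := ae_of_all _ fun x => abs_le.1 (hK x)
  have hgi : Integrable g ν := Integrable.of_mem_Icc (-K) K hgm.aemeasurable hgb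
  have hmK : |m| ≤ K := by
    refine (abs_integral_le_integral_abs).trans ?_
    calc ∫ x, |g x| ∂ν ≤ ∫ _x, K ∂ν := integral_mono hgi.abs (integrable_const K) fun x => hK x
      _ = K := by simp
  -- the centred statistic
  have hgm' : Measurable fun x => g x - m := hgm.sub_const m
  have hK' : ∀ x, |g x - m| ≤ 2 * K := fun x => by
    calc |g x - m| ≤ |g x| + |m| := abs_sub _ _
      _ ≤ K + K := add_le_add (hK x) hmK
      _ = 2 * K := by ring
  have h0' : ∫ x, (g x - m) ∂ν = 0 := by
    rw [integral_sub hgi (integrable_const m), integral_const]; simp [hm]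
  have hvar : Var[fun x => g x - m; ν] = Var[g; ν] := by
    simp_rw [sub_eq_add_neg]
    exact variance_add_const (hgi.aestronglyMeasurable) (-m)
  have h := tiltPi_meanAccept_diag_tendsto (ν := ν) hgm' hK' h0' c
  rw [hvar] at h
  refine h.congr fun n => ?_
  exact tiltPi_meanAccept_sub_const m (c / Real.sqrt n) n

/-- **COUPLING TRANSFER ON THE DIAGONAL.**  For EVERY block law `ν`, bounded block statistic `g`,
training coupling `β₀` and real `c`: the equilibrium acceptance of the perfectly trained factorised
flow (proposal `ν_{β₀}^{⊗n}`, `ν_{β₀} = ν.tilted (β₀ g)`) transferred to the target at coupling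
`β₀ + c/√n` converges to the log-normal acceptance law with `s = c²·Var_{ν_{β₀}}(g)`. [ours] -/
theorem tiltedPi_transfer_diag_tendsto (hgm : Measurable g) {K : ℝ} (hK : ∀ x, |g x| ≤ K)
    (β₀ c : ℝ) :
    Tendsto (fun n : ℕ =>
        (∫ x, ∫ y, min (Real.exp (c / Real.sqrt n * ∑ i, g (x i)))
              (Real.exp (c / Real.sqrt n * ∑ i, g (y i)))
            ∂(Measure.pi fun _ : Fin n => ν.tilted fun x => β₀ * g x)
            ∂(Measure.pi fun _ : Fin n => ν.tilted fun x => β₀ * g x))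
          / ∫ x, Real.exp (c / Real.sqrt n * ∑ i, g (x i))
            ∂(Measure.pi fun _ : Fin n => ν.tilted fun x => β₀ * g x))
      atTop (𝓝 (∫ x, ∫ y, min (Real.exp x) (Real.exp y)
        ∂(noiseLaw (c ^ 2 * Var[g; ν.tilted fun x => β₀ * g x]).toNNReal)
        ∂(noiseLaw (c ^ 2 * Var[g; ν.tilted fun x => β₀ * g x]).toNNReal))) := by
  have hgb : ∀ᵐ x ∂ν, g x ∈ Set.Icc (-K) K := ae_of_all _ fun x => abs_le.1 (hK x)
  haveI : IsProbabilityMeasure (ν.tilted fun x => β₀ * g x) :=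
    isProbabilityMeasure_tilted (integrable_exp_mul_of_mem_Icc hgm.aemeasurable hgb)
  exact tiltPi_meanAccept_diag_tendsto_of_bounded hgm hK c

/-- **THE TRANSFER PROFILE IS `erfc(|c|σ(β₀)/2)`** (`c ≠ 0`, block heat capacity
`σ(β₀)² = Var_{ν_{β₀}}(g) ≠ 0`). [ours] -/
theorem tiltedPi_transfer_diag_tendsto_erfc (hgm : Measurable g) {K : ℝ} (hK : ∀ x, |g x| ≤ K)
    (β₀ : ℝ) {c : ℝ} (hc : c ≠ 0) (hσ : Var[g; ν.tilted fun x => β₀ * g x] ≠ 0) :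
    Tendsto (fun n : ℕ =>
        (∫ x, ∫ y, min (Real.exp (c / Real.sqrt n * ∑ i, g (x i)))
              (Real.exp (c / Real.sqrt n * ∑ i, g (y i)))
            ∂(Measure.pi fun _ : Fin n => ν.tilted fun x => β₀ * g x)
            ∂(Measure.pi fun _ : Fin n => ν.tilted fun x => β₀ * g x))
          / ∫ x, Real.exp (c / Real.sqrt n * ∑ i, g (x i))
            ∂(Measure.pi fun _ : Fin n => ν.tilted fun x => β₀ * g x))
      atTop (𝓝 (2 / Real.sqrt Real.pi
        * ∫ u in Ioi (Real.sqrt (c ^ 2 * Var[g; ν.tilted fun x => β₀ * g x]) / 2),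
            Real.exp (-u ^ 2))) := by
  have hpos : 0 < c ^ 2 * Var[g; ν.tilted fun x => β₀ * g x] :=
    mul_pos (by positivity) (lt_of_le_of_ne (variance_nonneg _ _) (Ne.symm hσ))
  have hs : (c ^ 2 * Var[g; ν.tilted fun x => β₀ * g x]).toNNReal ≠ 0 := fun h =>
    absurd (Real.toNNReal_eq_zero.1 h) (not_le.2 hpos)
  have h := tiltedPi_transfer_diag_tendsto (ν := ν) hgm hK β₀ c
  rw [Scoring.imh_lognormal_accRate_eq_erfc hs, Real.coe_toNNReal _ hpos.le] at h
  exact h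

/-! ## One-plaquette blocks of any compact gauge group -/

section CompactGroupBlocks

open Literature.MathematicalPhysics.QuantumFieldTheory

variable {N : ℕ} {G : Type*} [Group G] [TopologicalSpace G] [IsTopologicalGroup G] [CompactSpace G]
  [MeasurableSpace G] [BorelSpace G] (ρ : G →* Matrix (Fin N) (Fin N) ℂ)

/-- **ANY COMPACT GAUGE GROUP, FACTORISED ONE-PLAQUETTE MODEL, ON THE DIAGONAL.**  For a continuous
representation `ρ` with `|Re tr ρ| ≤ N`, the untrained exact sampler of `V` independent `G`-plaquettes
(proposal `Haar^{⊗V}`, Wilson weight `e^{β Σ_p Re tr ρ(U_p)}`) at `β = c/√V` has acceptance converging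
to the log-normal law `∫∫ min(e^x, e^y) dN(−s/2, s)²`, `s = c²·Var_Haar(Re tr ρ)`. [ours] -/
theorem haarPi_meanAccept_diag_tendsto (hρ : Continuous ρ) (htr : ∀ g : G, |(ρ g).trace.re| ≤ N)
    (c : ℝ) :
    Tendsto (fun n : ℕ =>
        (∫ x, ∫ y, min (Real.exp (c / Real.sqrt n * ∑ i, (ρ (x i)).trace.re))
              (Real.exp (c / Real.sqrt n * ∑ i, (ρ (y i)).trace.re))
            ∂(Measure.pi fun _ : Fin n => haarProbability G)
            ∂(Measure.pi fun _ : Fin n => haarProbability G))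
          / ∫ x, Real.exp (c / Real.sqrt n * ∑ i, (ρ (x i)).trace.re)
            ∂(Measure.pi fun _ : Fin n => haarProbability G))
      atTop (𝓝 (∫ x, ∫ y, min (Real.exp x) (Real.exp y)
        ∂(noiseLaw (c ^ 2 * Var[fun g : G => (ρ g).trace.re; haarProbability G]).toNNReal)
        ∂(noiseLaw (c ^ 2 * Var[fun g : G => (ρ g).trace.re; haarProbability G]).toNNReal))) :=
  tiltPi_meanAccept_diag_tendsto_of_bounded (ν := haarProbability G)
    (g := fun U : G => (ρ U).trace.re)
    (Complex.continuous_re.comp (Continuous.matrix_trace hρ)).measurable (K := (N : ℝ)) htr c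

end CompactGroupBlocks

end Summit.Ventures.LatticeQCDFlow.Theory2

end
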